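import Literature.AlgebraicGeometry.Modules.LinearOverBase
import Mathlib.CategoryTheory.Linear.LinearFunctor
import HarnessLib

/-!
# Push-forward of `𝒪`-modules along a morphism of `k`-schemes is `k`-linear

Layer `Literature/AlgebraicGeometry/Modules`. For a morphism `g : X ⟶ Z` in `Over (Spec k)` (a morphism of `k`-schemes),
Mathlib's push-forward `g_* : Mod 𝒪_X ⥤ Mod 𝒪_Z` (`Scheme.Modules.pushforward g.left`) is `k`-LINEAR for the tree's
`instLinearOverBase` (`Modules/LinearOverBase.lean`: `c ∈ k` acts through the structure map `k → Γ(X, 𝒪_X)`):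
`g_*(c • φ) = c • g_*φ`. Proof on sections: `(g_*(c•φ))_U = (c•φ)_{g⁻¹U} = c|_{g⁻¹U} • φ_{g⁻¹U}`, while `c` acts on
`Γ(g_*N, U) = Γ(N, g⁻¹U)` through `g♯_U`, and `g♯_U(c|_U) = c|_{g⁻¹U}` because `g` is a morphism OVER `Spec k`
(`Over.w`). [cite: GortzWedhorn2020, §(7.3), (7.3.6) (the Γ(X,𝒪_X)-module structure on Hom; reading: compatibility with f_*)]
Motivation: venture HSemireg — `D(e_*)`/`D(e^*)` is then `ℂ`-linear, so ALL `Ext`-ranks `extRank` transport along an isomorphism of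
`ℂ`-schemes (`Summits/Ventures/HSemireg/AmplificationChainSigmaGluableOfSchemeIso.lean` proves the rank-`0` case without linearity).
-/

noncomputable section

-- `TopCat.Presheaf`/`Scheme.Modules` are not reducible (as in Mathlib's `AlgebraicGeometry/Modules/Sheaf.lean`).
set_option backward.isDefEq.respectTransparency false

open CategoryTheory AlgebraicGeometry Opposite TopologicalSpace
open AlgebraicGeometry.Scheme.Modules

universe u

namespace Literature.AlgebraicGeometry.Modules

variable {k : Type u} [CommRing k] {X Z : Over (Spec (CommRingCat.of k))} (g : X ⟶ Z)

/-- **`g♯` maps the scalar `c` on `U ⊆ Z` to the scalar `c` on `g⁻¹U ⊆ X`** for a morphism `g` of `k`-schemes: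
`g♯_U (c|_U) = c|_{g⁻¹U}` (`g.left ≫ Z.hom = X.hom`). [cite: GortzWedhorn2020, §(7.3), (7.3.6) (reading: the scalar c ∈ k on a k-scheme is the image of c under the structure map, compatible with k-morphisms)] -/
theorem app_scalarRingHomTop_res (U : Z.left.Opens) (c : k) :
    g.left.app U (Z.left.presheaf.map (homOfLE (le_top : U ≤ ⊤)).op (scalarRingHomTop Z c)) =
      X.left.presheaf.map (homOfLE (le_top : g.left ⁻¹ᵁ U ≤ ⊤)).op (scalarRingHomTop X c) := by
  have hw : g.left ≫ Z.hom = X.hom := Over.w g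
  rw [scalarRingHomTop_apply, scalarRingHomTop_apply, ← hw, Scheme.Hom.comp_appTop]
  change (Z.left.presheaf.map (homOfLE (le_top : U ≤ ⊤)).op ≫ g.left.app U)
      (Z.hom.appTop ((Scheme.ΓSpecIso (CommRingCat.of k)).inv c)) =
    (g.left.appTop ≫ X.left.presheaf.map (homOfLE (le_top : g.left ⁻¹ᵁ U ≤ ⊤)).op)
      (Z.hom.appTop ((Scheme.ΓSpecIso (CommRingCat.of k)).inv c))
  rw [Scheme.Hom.naturality]
  rfl

/-- **Push-forward along a morphism of `k`-schemes is `k`-linear**: `g_*(c • φ) = c • g_*φ` for the tree's `k`-linear structures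
`instLinearOverBase` on `Mod 𝒪_X`, `Mod 𝒪_Z`. [cite: GortzWedhorn2020, §(7.3), (7.3.6)] -/
theorem pushforward_map_base_smul {M N : X.left.Modules} (φ : M ⟶ N) (c : k) :
    (pushforward g.left).map (c • φ) = c • (pushforward g.left).map φ := by
  apply Scheme.Modules.hom_ext
  intro U
  rw [pushforward_map_app]
  ext x
  change (c • φ).app (g.left ⁻¹ᵁ U) x = (c • (pushforward g.left).map φ).app U x
  rw [base_smul_app_apply, base_smul_app_apply, pushforward_map_app]
  change _ = g.left.app U (Z.left.presheaf.map (homOfLE (le_top : U ≤ ⊤)).op (scalarRingHomTop Z c)) •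
    φ.app (g.left ⁻¹ᵁ U) x
  rw [app_scalarRingHomTop_res]

/-- `g_*` is a `k`-linear functor (as a `Prop`-valued structure, to be introduced with `haveI`). [cite: GortzWedhorn2020, §(7.3), (7.3.6)] -/
theorem linear_pushforward : Functor.Linear k (pushforward g.left) :=
  { map_smul := fun φ c => pushforward_map_base_smul g φ c }

end Literature.AlgebraicGeometry.Modules

end
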